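import Mathlib.Analysis.InnerProductSpace.Projection.FiniteDimensional
import Mathlib.LinearAlgebra.LinearIndependent.Lemmas
import Mathlib.Algebra.BigOperators.Ring.Finset
import HarnessLib

/-!
# One step of the Micciancio–Regev short-set iteration (MR07 Lemma 5.10, `GIVP → IncGDD`)

Topic `Algebra/EuclideanLattices` (family `pqc`). Fully PROVED deterministic content of the
iterative reduction of **Micciancio–Regev 2007, Lemma 5.10** (authors' version p. 24), which produces
the short linearly independent set `S` needed by MR07 Cor. 5.13 and hence by the proof of Thm. 5.23
(`Literature.Computability.Cryptography.MicciancioRegev2007_gapCVP'_to_SIS'`: "using Corollary 5.13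
(with `F` as an oracle), we obtain a set of `n` linearly independent vectors `S` in `L(B)*` such that
`‖S‖ ≤ 8β√n η_ε(B*)`", p. 29). Written for the decomposition of that fact; Mathlib only.

The printed step: "we identify the longest vector in `S`, say `sᵢ`. We then take `t` to be a vector
orthogonal to `s₁, …, sᵢ₋₁, sᵢ₊₁, …, sₙ` of length `‖S‖/2`. We apply the IncGDD oracle with the
instance `(B, S, t, ‖S‖/8)`. If it fails, we abort and output `S`. Otherwise, we obtain a lattice
vector `u` within distance at most `(‖S‖/8) + ‖S‖/8 = ‖S‖/4` from `t`. Notice that `‖u‖ ≤ 3‖S‖/4`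
and that it is linearly independent from the vectors in `s₁, …, sᵢ₋₁, sᵢ₊₁, …, sₙ`. We then
replace `sᵢ` with `u` and repeat the process."

## Results (`V` a real inner product space, `s : Fin n → V` linearly independent, `i : Fin n`,
## `W = span_ℝ {sⱼ | j ≠ i}`)

* `MicciancioRegev2007.exists_orthogonal_norm_eq` — the vector `t`: for every `r ≥ 0` there is
  `t ∈ Wᗮ` with `‖t‖ = r` (the normalised component of `sᵢ` orthogonal to `W`, nonzero by linear
  independence; `V` finite-dimensional).
* `MicciancioRegev2007.notMem_span_of_norm_sub_lt` — if `t ∈ Wᗮ` and `‖u - t‖ < ‖t‖` then `u ∉ W`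
  (for `u ∈ W`, `‖u - t‖² = ‖u‖² + ‖t‖²`).
* `linearIndependent_update_of_notMem_span` — replacing `sᵢ` by any `u ∉ W` keeps linear
  independence (elementary; Mathlib's `LinearIndependent.update` covers only `u ∈ span s`).
* `MicciancioRegev2007.shortening_step` — **the step**: if `‖sⱼ‖ ≤ ‖sᵢ‖` for all `j` (so
  `‖S‖ = ‖sᵢ‖`), `t ∈ Wᗮ`, `‖t‖ = ‖S‖/2` and `‖u - t‖ ≤ ‖S‖/4`, then the updated family is linearly
  independent, `‖u‖ ≤ 3‖S‖/4`, its maximal norm is still `≤ ‖S‖`, and the potential `∏ⱼ ‖sⱼ‖` drops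
  by the factor `3/4` (`prod_norm_update_le`).
* `MicciancioRegev2007.pow_le_prod_norm` — termination: if every nonzero lattice vector has norm
  `≥ λ > 0` (`λ = λ₁(L)`), the potential of `n` nonzero lattice vectors is `≥ λⁿ`; with the factor
  `3/4` per successful step this bounds the number of successful oracle calls by
  `log_{4/3}(∏ⱼ ‖bⱼ‖ / λⁿ)` (print: "`log ∏ᵢ ‖sᵢ‖` decreases by a constant at each step, and its
  initial value is polynomial in the input size"; the lower bound via `λ₁` replaces the determinant).

Not here: the IncGDD oracle, the output guarantee `‖S‖ ≤ 8γφ(B)` (which is the definition of a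
failing IncGDD call, `r = ‖S‖/8 ≤ γφ(B)`), and the machine.

## References

* D. Micciancio, O. Regev, *Worst-case to average-case reductions based on Gaussian measures*,
  SIAM J. Comput. 37 (2007) 267–302; authors' version, Def. 5.6 (IncGDD, p. 19), Lemma 5.10 and its
  proof (p. 24), Cor. 5.13 (p. 25), Thm. 5.23 (p. 29) (`lit read doi:10.1137/S0097539705447360`).
* D. Micciancio, *Almost perfect lattices, the covering radius problem, and applications to Ajtai's
  connection factor*, SIAM J. Comput. 34 (2004), §7 (the original iteration, MR07's ref. [22]).
-/

noncomputable section

open Finset Module Submodule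
open scoped InnerProductSpace RealInnerProductSpace

namespace Literature.Algebra.EuclideanLattices

variable {V : Type*} [NormedAddCommGroup V] [InnerProductSpace ℝ V] {n : ℕ}

/-- Replacing one vector of a linearly independent family by a vector outside the span of the others
keeps the family linearly independent. [folklore] -/
theorem linearIndependent_update_of_notMem_span {s : Fin n → V} (hs : LinearIndependent ℝ s)
    (i : Fin n) {u : V} (hu : u ∉ span ℝ (s '' {i}ᶜ)) :
    LinearIndependent ℝ (Function.update s i u) := by
  classical
  rw [Fintype.linearIndependent_iff]
  intro g hg
  -- split off the `i`-th term
  have hsplit : ∑ j, g j • Function.update s i u j =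
      g i • u + ∑ j ∈ univ.erase i, g j • s j := by
    rw [← Finset.add_sum_erase _ _ (mem_univ i), Function.update_self]
    congr 1
    refine Finset.sum_congr rfl fun j hj => ?_
    rw [Function.update_of_ne (Finset.ne_of_mem_erase hj)]
  rw [hsplit] at hg
  have hW : ∑ j ∈ univ.erase i, g j • s j ∈ span ℝ (s '' {i}ᶜ) :=
    Submodule.sum_mem _ fun j hj =>
      Submodule.smul_mem _ _ (subset_span ⟨j, Finset.ne_of_mem_erase hj, rfl⟩)
  -- the coefficient of `u` vanishes
  have hgi : g i = 0 := by
    by_contra hne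
    apply hu
    have : u = -((g i)⁻¹ • ∑ j ∈ univ.erase i, g j • s j) := by
      have h := congrArg (fun v => (g i)⁻¹ • v) hg
      simp only [smul_add, smul_smul, inv_mul_cancel₀ hne, one_smul, smul_zero] at h
      exact eq_neg_of_add_eq_zero_left h
    rw [this]
    exact Submodule.neg_mem _ (Submodule.smul_mem _ _ hW)
  -- the remaining relation is a relation among the `sⱼ`
  rw [hgi, zero_smul, zero_add] at hg
  have hrel : ∑ j, Function.update g i 0 j • s j = 0 := by
    rw [← Finset.add_sum_erase _ _ (mem_univ i), Function.update_self, zero_smul, zero_add]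
    rw [← hg]
    refine Finset.sum_congr rfl fun j hj => ?_
    rw [Function.update_of_ne (Finset.ne_of_mem_erase hj)]
  have hall := Fintype.linearIndependent_iff.1 hs (Function.update g i 0) hrel
  intro j
  by_cases hji : j = i
  · rw [hji, hgi]
  · have := hall j
    rwa [Function.update_of_ne hji] at this

/-- **`u` close to `t ⊥ W` is not in `W`** (MR07 Lemma 5.10: "`u` … is linearly independent from
the vectors `s₁, …, sᵢ₋₁, sᵢ₊₁, …, sₙ`"): if `t ∈ Wᗮ` and `‖u - t‖ < ‖t‖` then `u ∉ W`, because for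
`u ∈ W` Pythagoras gives `‖u - t‖² = ‖u‖² + ‖t‖² ≥ ‖t‖²`.
[cite: MicciancioRegev2007, Lemma 5.10 (proof, p. 24)] -/
theorem MicciancioRegev2007.notMem_span_of_norm_sub_lt {W : Submodule ℝ V} {t u : V}
    (ht : t ∈ Wᗮ) (hut : ‖u - t‖ < ‖t‖) : u ∉ W := by
  intro hu
  have h0 : ⟪u, t⟫ = 0 := Submodule.inner_right_of_mem_orthogonal hu ht
  have hsq : ‖u - t‖ ^ 2 = ‖u‖ ^ 2 + ‖t‖ ^ 2 := by
    rw [norm_sub_sq_real, h0, mul_zero, sub_zero]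
  have : ‖t‖ ^ 2 ≤ ‖u - t‖ ^ 2 := by rw [hsq]; nlinarith [norm_nonneg u]
  have := (sq_le_sq₀ (norm_nonneg _) (norm_nonneg _)).1 this
  linarith

/-- **The target direction of MR07 Lemma 5.10**: for a linearly independent family `s` in a
finite-dimensional inner product space and `r ≥ 0` there is a vector `t` of norm exactly `r`
orthogonal to all `sⱼ`, `j ≠ i` — take the component of `sᵢ` orthogonal to `W = span {sⱼ | j ≠ i}`,
which is nonzero since `sᵢ ∉ W`, and rescale. [cite: MicciancioRegev2007, Lemma 5.10 (proof, p. 24)] -/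
theorem MicciancioRegev2007.exists_orthogonal_norm_eq [FiniteDimensional ℝ V] {s : Fin n → V}
    (hs : LinearIndependent ℝ s) (i : Fin n) {r : ℝ} (hr : 0 ≤ r) :
    ∃ t ∈ (span ℝ (s '' {i}ᶜ))ᗮ, ‖t‖ = r := by
  set W : Submodule ℝ V := span ℝ (s '' {i}ᶜ) with hW
  set p : V := s i - W.starProjection (s i) with hp
  have hpW : p ∈ Wᗮ := W.sub_starProjection_mem_orthogonal (s i)
  have hp0 : p ≠ 0 := by
    intro h
    have hsi : s i ∈ W := by
      have : s i = W.starProjection (s i) := sub_eq_zero.1 h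
      rw [this]
      exact W.starProjection_apply_mem _
    exact hs.notMem_span_image (Set.notMem_compl_iff.2 (Set.mem_singleton i)) hsi
  refine ⟨(r / ‖p‖) • p, Wᗮ.smul_mem _ hpW, ?_⟩
  rw [norm_smul, Real.norm_eq_abs, abs_of_nonneg (div_nonneg hr (norm_nonneg _)),
    div_mul_cancel₀ _ (norm_ne_zero_iff.2 hp0)]

omit [InnerProductSpace ℝ V] in
/-- Norm bookkeeping of the step: `‖u‖ ≤ ‖t‖ + ‖u - t‖ ≤ ‖S‖/2 + ‖S‖/4 = 3‖S‖/4`.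
[cite: MicciancioRegev2007, Lemma 5.10 (proof, p. 24)] -/
theorem MicciancioRegev2007.norm_le_three_quarters {t u : V} {M : ℝ} (ht : ‖t‖ = M / 2)
    (hut : ‖u - t‖ ≤ M / 4) : ‖u‖ ≤ 3 / 4 * M := by
  have := norm_le_insert' u t   -- ‖u‖ ≤ ‖t‖ + ‖u - t‖
  linarith

omit [InnerProductSpace ℝ V] in
/-- The potential of MR07 Lemma 5.10: replacing `sᵢ` by `u` with `‖u‖ ≤ (3/4)‖sᵢ‖` multiplies
`∏ⱼ ‖sⱼ‖` by at most `3/4`. [cite: MicciancioRegev2007, Lemma 5.10 (proof, p. 24)] -/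
theorem MicciancioRegev2007.prod_norm_update_le {s : Fin n → V} (i : Fin n) {u : V}
    (hu : ‖u‖ ≤ 3 / 4 * ‖s i‖) :
    ∏ j, ‖Function.update s i u j‖ ≤ 3 / 4 * ∏ j, ‖s j‖ := by
  classical
  rw [← Finset.mul_prod_erase _ _ (mem_univ i), ← Finset.mul_prod_erase univ (fun j => ‖s j‖) (mem_univ i),
    Function.update_self, ← mul_assoc]
  have heq : ∏ j ∈ univ.erase i, ‖Function.update s i u j‖ = ∏ j ∈ univ.erase i, ‖s j‖ :=
    Finset.prod_congr rfl fun j hj => by rw [Function.update_of_ne (Finset.ne_of_mem_erase hj)]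
  rw [heq]
  exact mul_le_mul_of_nonneg_right hu (Finset.prod_nonneg fun j _ => norm_nonneg _)

/-- **One step of MR07 Lemma 5.10** (p. 24): let `s` be linearly independent with longest vector
`sᵢ` (`‖S‖ = ‖sᵢ‖`), `t ⊥ span {sⱼ | j ≠ i}` with `‖t‖ = ‖S‖/2`, and `u` with `‖u - t‖ ≤ ‖S‖/4` (the
IncGDD oracle's answer on `(B, S, t, ‖S‖/8)`: distance `≤ ‖S‖/8 + ‖S‖/8`). Then the family with `sᵢ`
replaced by `u` is linearly independent, `‖u‖ ≤ 3‖S‖/4`, all its vectors still have norm `≤ ‖S‖`,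
and `∏ⱼ ‖sⱼ‖` drops by the factor `3/4`. (That `u ∈ L(B)` keeps the family inside the lattice is
immediate and not part of the statement.) [cite: MicciancioRegev2007, Lemma 5.10 (proof, p. 24)] -/
theorem MicciancioRegev2007.shortening_step {s : Fin n → V} (hs : LinearIndependent ℝ s) {i : Fin n}
    (hmax : ∀ j, ‖s j‖ ≤ ‖s i‖) {t : V} (ht : t ∈ (span ℝ (s '' {i}ᶜ))ᗮ)
    (htn : ‖t‖ = ‖s i‖ / 2) {u : V} (hut : ‖u - t‖ ≤ ‖s i‖ / 4) :
    LinearIndependent ℝ (Function.update s i u) ∧ ‖u‖ ≤ 3 / 4 * ‖s i‖ ∧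
      (∀ j, ‖Function.update s i u j‖ ≤ ‖s i‖) ∧
      ∏ j, ‖Function.update s i u j‖ ≤ 3 / 4 * ∏ j, ‖s j‖ := by
  have hsi : 0 < ‖s i‖ := norm_pos_iff.2 (hs.ne_zero i)
  have hlt : ‖u - t‖ < ‖t‖ := by rw [htn]; linarith
  have hu : ‖u‖ ≤ 3 / 4 * ‖s i‖ := MicciancioRegev2007.norm_le_three_quarters htn hut
  refine ⟨linearIndependent_update_of_notMem_span hs i
      (MicciancioRegev2007.notMem_span_of_norm_sub_lt ht hlt), hu, fun j => ?_,
    MicciancioRegev2007.prod_norm_update_le i hu⟩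
  by_cases hji : j = i
  · subst hji
    rw [Function.update_self]
    linarith
  · rw [Function.update_of_ne hji]
    exact hmax j

omit [InnerProductSpace ℝ V] in
/-- **Termination of MR07 Lemma 5.10 via `λ₁`**: if every nonzero vector of the lattice has norm at
least `λ > 0` then `n` nonzero lattice vectors have `∏ⱼ ‖sⱼ‖ ≥ λⁿ`; since each successful step
multiplies the potential by `≤ 3/4` (`prod_norm_update_le`), at most `log_{4/3}(∏ⱼ ‖bⱼ‖/λⁿ)` steps
succeed (print: "`log ∏ᵢ ‖sᵢ‖` decreases by a constant at each step"). [cite: MicciancioRegev2007, Lemma 5.10 (proof, p. 24) — variant] -/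
theorem MicciancioRegev2007.pow_le_prod_norm {L : Set V} {lam : ℝ} (hlam : 0 ≤ lam)
    (hL : ∀ v ∈ L, v ≠ 0 → lam ≤ ‖v‖) {s : Fin n → V} (hsL : ∀ j, s j ∈ L) (hs0 : ∀ j, s j ≠ 0) :
    lam ^ n ≤ ∏ j, ‖s j‖ := by
  calc lam ^ n = ∏ _j : Fin n, lam := by simp
    _ ≤ ∏ j, ‖s j‖ := Finset.prod_le_prod (fun j _ => hlam) fun j _ => hL _ (hsL j) (hs0 j)

/-- The step count: if the potential starts at `P0`, is always `≥ λⁿ > 0`, and drops by the factor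
`3/4` at each of `k` steps, then `(4/3)ᵏ ≤ P0/λⁿ`. [cite: MicciancioRegev2007, Lemma 5.10 (proof, p. 24) — variant] -/
theorem MicciancioRegev2007.steps_bound {P0 low : ℝ} (hlow : 0 < low) {k : ℕ} {Pk : ℝ}
    (hk : Pk ≤ (3 / 4) ^ k * P0) (hPk : low ≤ Pk) : (4 / 3 : ℝ) ^ k ≤ P0 / low := by
  rw [le_div_iff₀ hlow]
  have h34 : (0 : ℝ) < (3 / 4) ^ k := by positivity
  have : (4 / 3 : ℝ) ^ k * (3 / 4) ^ k = 1 := by rw [← mul_pow]; norm_num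
  nlinarith [hPk.trans hk]

end Literature.Algebra.EuclideanLattices

end
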